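import Summits.QuantumFields.BalabanUV.T4Continuum.Spine.NE2.OneStepRemainderLipschitz

/-!
# T⁴ programme, spine node NE2 (U1a) — R14 W3a, file 2: THE COMPOSED REMAINDER `E″_k` AS A FUNCTION OF ITS DATA — cross-problem Lipschitz law by telescoping the composed full averaging
# (cell `pub-balaban-gaps`, seat ne2 gen 5; plan `ne/NE2-R14-PLAN.md` STATUS v5, item W3a)

The sandwiched two-level fields `hRem₂`/`hRem₃` of `ComposedFullAveragingRate.composed_full_averaging_rate` compare `E″` of the problem at level `k+1` (data `W^{(k+1)}, C^{(k+1)}`) with `E″` of the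
problem at level `k` (data `W^{(k)}, C^{(k)}`).  Splitting `E″^{(k+1)}_{k+1}(J⊗1) − E″^{(k)}_k = [E″^{(k+1)}_{k+1}(J⊗1) − E″^{(k+1)}_k] + [E″^{(k+1)}_k − E″^{(k)}_k]`, the second bracket is the
CROSS-PROBLEM term at a fixed level, which THIS FILE bounds in operator norm (no sandwich needed):
 * `QcovT_sub_QcovT_eq`, **`opNorm_QcovT_sub_QcovT_le`** (`‖Q_k(T′) − Q_k(T)‖ ≤ card o·θ·(√(n^d))⁻¹` from entrywise `‖T′ − T‖ ≤ θ`), **`opNorm_EcovT_sub_EcovT_le`**;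
 * **`sqrtVol_smul_QfullLev_sub_succ`**: the recursion `D_{k+1} = √(L^d)·(D_k·Q^{lin′}_k + (√(n_k^d)Q^{full}_k)·(Q^{lin′}_k − Q^{lin}_k))` for `D_k := √(n_k^d)(Q^{full′}_k − Q^{full}_k)`;
 * `opNorm_QlinStep_le`, `opNorm_QlinStep_sub_le` (from file 1 of W3a and files 2–3 of W3), and by induction **`opNorm_sqrtVol_smul_QfullLev_sub_le`**:
   `‖D_k‖ ≤ F·(Σ_{i<k} Δ_i)·Π_{i<k}(1 + ε′_i)` with `Δ_i = card o·δS_i + c_R(δG_i + γ_i(δR_i + 2δS_i))`, `δS_i = (1 + c_{i+1})^{(d+1)L} − 1`, `ε′_i = card o·σ′_i + c_Rγ′_i`, and `F` a bound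
   on `‖√(n_i^d)Q^{full}_i‖` (supplied by `Bfree_add_EcovT_add_Erem` + `opNorm_Erem_le`: `F = 1 + card o·τ + r`);
 * **`opNorm_Erem_sub_Erem_le`**: `‖E″(W′,C′)_k − E″(W,C)_k‖ ≤ ‖D_k‖ + card o·θ` with `θ` the entrywise bound on `T_Bal(W′) − T_Bal(W)` at THAT level `k` (gen 4's `consBal` via
   `norm_prefix_sub_prefix_le`).
With NE3-type letters (`c_i`, `δG_i`, `δR_i` of size `σθ_c^k`-type, geometric sums) the right-hand sides are `O(θ_c^k)` uniformly — the cross-problem half of W3a; the same-data half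
(`E″_{k+1}(J⊗1) − E″_k` against `Δ_a⁻¹`, King's mechanism) remains.
HONEST FRAMING (T4-DAG p. 1).  Bookkeeping about typed operator shapes whose data are DISPLAYED; NOT NE2, NOT [B7] (124)/(143) beyond the displayed reading; **NE2 (U1a) NOT PROVED**; spine
PROVED 0/9 unchanged; NOT continuum YM / infinite volume / mass gap / Clay.  HONEST DEPENDENCY: continuum YM on T⁴ ⇐ BetaPertH ∧ nine spine estimates (0/9 proved); BetaPertH ⇐ (D1) ∧ (D4)
∧ CAP+tail.  No `sorry`.
-/

noncomputable section

open scoped BigOperators ComplexConjugate Matrix Matrix.Norms.L2Operator Kronecker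
open Finset (range)

namespace Summit.QuantumFields.BalabanUV.T4Continuum.NE2.ComposedRemainderLipschitz

open Literature.MathematicalPhysics.QuantumFieldTheory.Balaban1983to89.B5Prop11Plancherel (Tor fine unitVec)
open Literature.MathematicalPhysics.QuantumFieldTheory.Balaban1983to89.B5Block118 (QvOp bpt tstep)
open Literature.MathematicalPhysics.QuantumFieldTheory.Balaban1983to89.B5G183RateUnitTower (lev lev_neZero)
open Summit.QuantumFields.BalabanUV.T4Continuum
open Summit.QuantumFields.BalabanUV.T4Continuum.BalabanAveragedTowerUnit (idx norm_entry_le_opNorm)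
open Summit.QuantumFields.BalabanUV.T4Continuum.CovariantBlockAveraging (sqrtVol norm_sqrtVol Bfree)
open Summit.QuantumFields.BalabanUV.T4Continuum.CovariantVectorChartModulus (norm_transport_le_one)
open Summit.QuantumFields.BalabanUV.T4Continuum.NE2.CovariantTableAveraging (Table QcovT QcovT_const_one opNorm_QcovT_sub_kron_le)
open Summit.QuantumFields.BalabanUV.T4Continuum.NE2.CovariantTableTower (QcovLevT EcovT)
open Summit.QuantumFields.BalabanUV.T4Continuum.NE2.CovariantTableBalaban (TBal)
open Summit.QuantumFields.BalabanUV.T4Continuum.NE2.ComposedAveragingIdentity (Qstep TBal_zero)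
open Summit.QuantumFields.BalabanUV.T4Continuum.NE2.OneStepRemainder (Smain Qrem opNorm_Qrem_le)
open Summit.QuantumFields.BalabanUV.T4Continuum.NE2.ComposedRemainderTower (opNorm_Qstep_le_one_add sqrtVol_succ RemCoeff QremStep QmainStep QlinStep QlinStep_eq QfullLev Erem
  Bfree_add_EcovT_add_Erem cR cR_nonneg)
open Summit.QuantumFields.BalabanUV.T4Continuum.NE2.OneStepRemainderLipschitz (norm_Smain_sub_Smain_le opNorm_Qstep_sub_Qstep_le opNorm_Qrem_sub_le)

variable {d : ℕ}

/-! ## §1 Table averagings as functions of the table -/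

section Table

variable (n : ℕ) [NeZero n] (M : Fin d → ℕ) [hM : ∀ μ, NeZero (M μ)] {o : Type*} [Fintype o] [DecidableEq o]

omit [NeZero n] hM [Fintype o] [DecidableEq o] in
/-- the table averaging is ADDITIVE in its table: `Q_k(S + T) = Q_k(S) + Q_k(T)`. [folklore] -/
theorem QcovT_add (S T : Table d n M o) : QcovT n M (S + T) = QcovT n M S + QcovT n M T := by
  ext b i
  simp only [QcovT, Matrix.add_apply]
  by_cases h : i.1.2 = b.1.2
  · rw [if_pos h, if_pos h, if_pos h, ← Finset.sum_add_distrib]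
    refine Finset.sum_congr rfl fun j _ => ?_
    rw [← Finset.sum_add_distrib]
    refine Finset.sum_congr rfl fun t _ => ?_
    split_ifs
    · rw [Pi.add_apply, Pi.add_apply, Pi.add_apply, Pi.add_apply, Matrix.add_apply, mul_add]
    · rw [add_zero]
  · rw [if_neg h, if_neg h, if_neg h, add_zero]

omit [NeZero n] hM [Fintype o] [DecidableEq o] in
/-- hence `Q_k(T′) − Q_k(T) = Q_k(T′ − T)`. [folklore] -/
theorem QcovT_sub (T T' : Table d n M o) : QcovT n M T' - QcovT n M T = QcovT n M (T' - T) := by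
  rw [sub_eq_iff_eq_add, ← QcovT_add, sub_add_cancel]

/-- **`‖Q_k(T′) − Q_k(T)‖ ≤ card o·θ·(√(n^d))⁻¹`** from entrywise `‖T′ − T‖ ≤ θ` (`t < n`). [folklore] -/
theorem opNorm_QcovT_sub_QcovT_le {T T' : Table d n M o} {θ : ℝ} (hθ : 0 ≤ θ) (hT : ∀ y j μ (t : Fin n), ‖T' y j μ t - T y j μ t‖ ≤ θ) :
    ‖QcovT n M T' - QcovT n M T‖ ≤ Fintype.card o * θ * (Real.sqrt ((n : ℝ) ^ d))⁻¹ := by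
  have h1 : QcovT n M (1 : Table d n M o) = QvOp n M ⊗ₖ (1 : Matrix o o ℂ) := QcovT_const_one n M
  have e : QcovT n M T' - QcovT n M T = QcovT n M (T' - T + 1) - QvOp n M ⊗ₖ (1 : Matrix o o ℂ) := by
    rw [QcovT_add, h1, add_sub_cancel_right, QcovT_sub]
  rw [e]
  exact opNorm_QcovT_sub_kron_le n M hθ fun y j μ t => by
    rw [Pi.add_apply, Pi.add_apply, Pi.add_apply, Pi.add_apply, Pi.sub_apply, Pi.sub_apply, Pi.sub_apply, Pi.sub_apply, Pi.one_apply, Pi.one_apply,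
      Pi.one_apply, Pi.one_apply, add_sub_cancel_right]
    exact hT y j μ t

end Table

section Tower

variable (L : ℕ) [NeZero L] (M : Fin d → ℕ) [hM : ∀ μ, NeZero (M μ)] {o : Type*} [Fintype o] [DecidableEq o]

/-- **THE TRANSPORT ERRORS OF TWO TABLE TOWERS**: `‖E_k(T′) − E_k(T)‖ ≤ card o·θ_k` from entrywise `‖T′_k − T_k‖ ≤ θ_k`. [folklore] -/
theorem opNorm_EcovT_sub_EcovT_le {T T' : (k : ℕ) → Table d (lev L k) M o} {θ : ℝ} (hθ : 0 ≤ θ) (k : ℕ)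
    (hT : ∀ y j μ (t : Fin (lev L k)), ‖T' k y j μ t - T k y j μ t‖ ≤ θ) : ‖EcovT L M T' k - EcovT L M T k‖ ≤ Fintype.card o * θ := by
  haveI := lev_neZero L k
  have hpos : 0 < Real.sqrt (((lev L k : ℕ) : ℝ) ^ d) := Real.sqrt_pos.mpr (pow_pos (by exact_mod_cast Nat.pos_of_ne_zero (NeZero.ne (lev L k))) d)
  have e : EcovT L M T' k - EcovT L M T k = sqrtVol d L k • (QcovT (lev L k) M (T' k) - QcovT (lev L k) M (T k)) := by
    rw [EcovT, EcovT, ← smul_sub, QcovLevT, QcovLevT, sub_sub_sub_cancel_right]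
  rw [e, norm_smul, norm_sqrtVol]
  calc Real.sqrt (((lev L k : ℕ) : ℝ) ^ d) * ‖QcovT (lev L k) M (T' k) - QcovT (lev L k) M (T k)‖
      ≤ Real.sqrt (((lev L k : ℕ) : ℝ) ^ d) * (Fintype.card o * θ * (Real.sqrt (((lev L k : ℕ) : ℝ) ^ d))⁻¹) :=
        mul_le_mul_of_nonneg_left (opNorm_QcovT_sub_QcovT_le (lev L k) M hθ hT) hpos.le
    _ = Fintype.card o * θ := by field_simp

/-- **THE RECURSION FOR THE DIFFERENCE OF TWO COMPOSED FULL AVERAGINGS**: with `D_k := √(n_k^d)·(Q^{full}(W′,C′)_k − Q^{full}(W,C)_k)`,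
`D_{k+1} = √(L^d)·(D_k·Q^{lin}(W′,C′)_k + (√(n_k^d)·Q^{full}(W,C)_k)·(Q^{lin}(W′,C′)_k − Q^{lin}(W,C)_k))`. [folklore] -/
theorem sqrtVol_smul_QfullLev_sub_succ (W W' : (i : ℕ) → Fin d → (idx L M i → Matrix o o ℂ)) (C C' : RemCoeff d L M o) (k : ℕ) :
    sqrtVol d L (k + 1) • (QfullLev L M W' C' (k + 1) - QfullLev L M W C (k + 1))
      = ((Real.sqrt ((L : ℝ) ^ d) : ℝ) : ℂ) • ((sqrtVol d L k • (QfullLev L M W' C' k - QfullLev L M W C k)) * QlinStep L M W' C' k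
          + (sqrtVol d L k • QfullLev L M W C k) * (QlinStep L M W' C' k - QlinStep L M W C k)) := by
  rw [QfullLev, QfullLev, sqrtVol_succ, mul_smul]
  congr 1
  rw [Matrix.smul_mul, Matrix.smul_mul, ← smul_add, Matrix.sub_mul, Matrix.mul_sub]
  congr 1
  abel

/-- the size of a full step: `‖Q^{lin}_k‖ ≤ (1 + card o·σ + c_R·γ)·(√(L^d))⁻¹`. [folklore] -/
theorem opNorm_QlinStep_le [Nonempty o] {W : (i : ℕ) → Fin d → (idx L M i → Matrix o o ℂ)} {C : RemCoeff d L M o} {σ γ : ℝ} (hσ : 0 ≤ σ) (hγ : 0 ≤ γ) (k : ℕ)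
    (hWn : ∀ ν b, ‖W (k + 1) ν b‖ ≤ 1) (hS : ∀ x r μ (s : Fin L), ‖(haveI := lev_neZero L k; Smain (lev L k) L M (W (k + 1)) x r μ s) - 1‖ ≤ σ)
    (hG₁ : ∀ x μ r, ‖C.G₁ k x μ r‖ ≤ γ) (hG₂ : ∀ x μ r, ‖C.G₂ k x μ r‖ ≤ γ) (hG₃ : ∀ x μ, ‖C.G₃ k x μ‖ ≤ γ) (hRc : ∀ x μ, ‖C.Rc k x μ‖ ≤ 1) :
    ‖QlinStep L M W C k‖ ≤ (1 + Fintype.card o * σ + cR d L o * γ) * (Real.sqrt ((L : ℝ) ^ d))⁻¹ := by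
  haveI := lev_neZero L k
  rw [QlinStep_eq]
  have h1 : ‖QmainStep L M W k‖ ≤ (1 + Fintype.card o * σ) * (Real.sqrt ((L : ℝ) ^ d))⁻¹ := opNorm_Qstep_le_one_add (lev L k) L M hσ hS
  have h2 : ‖QremStep L M W C k‖ ≤ cR d L o * γ * (Real.sqrt ((L : ℝ) ^ d))⁻¹ := by
    refine (opNorm_Qrem_le (lev L k) L M hγ hWn hG₁ hG₂ hG₃ hRc).trans (le_of_eq ?_)
    rw [cR]; ring
  refine (norm_add_le _ _).trans ((add_le_add h1 h2).trans (le_of_eq ?_))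
  ring

/-- the difference of two full steps: `‖Q^{lin}(W′,C′)_k − Q^{lin}(W,C)_k‖ ≤ (card o·δS + c_R·(δG + γ(δR + 2δS)))·(√(L^d))⁻¹`, `δS = (1 + c)^{(d+1)L} − 1`. [folklore] -/
theorem opNorm_QlinStep_sub_le [Nonempty o] {W W' : (i : ℕ) → Fin d → (idx L M i → Matrix o o ℂ)} {C C' : RemCoeff d L M o} {γ c δG δR : ℝ}
    (hγ : 0 ≤ γ) (hc : 0 ≤ c) (hδG : 0 ≤ δG) (hδR : 0 ≤ δR) (k : ℕ)
    (hWn : ∀ ν b, ‖W (k + 1) ν b‖ ≤ 1) (hW'n : ∀ ν b, ‖W' (k + 1) ν b‖ ≤ 1) (hWW : ∀ ν b, ‖W' (k + 1) ν b - W (k + 1) ν b‖ ≤ c)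
    (hG₁ : ∀ x μ r, ‖C.G₁ k x μ r‖ ≤ γ) (hG₂ : ∀ x μ r, ‖C.G₂ k x μ r‖ ≤ γ) (hG₃ : ∀ x μ, ‖C.G₃ k x μ‖ ≤ γ) (hRc : ∀ x μ, ‖C.Rc k x μ‖ ≤ 1) (hRc' : ∀ x μ, ‖C'.Rc k x μ‖ ≤ 1)
    (hGG₁ : ∀ x μ r, ‖C'.G₁ k x μ r - C.G₁ k x μ r‖ ≤ δG) (hGG₂ : ∀ x μ r, ‖C'.G₂ k x μ r - C.G₂ k x μ r‖ ≤ δG) (hGG₃ : ∀ x μ, ‖C'.G₃ k x μ - C.G₃ k x μ‖ ≤ δG)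
    (hRR : ∀ x μ, ‖C'.Rc k x μ - C.Rc k x μ‖ ≤ δR) :
    ‖QlinStep L M W' C' k - QlinStep L M W C k‖
      ≤ (Fintype.card o * ((1 + c) ^ ((d + 1) * L) - 1) + cR d L o * (δG + γ * (δR + 2 * ((1 + c) ^ ((d + 1) * L) - 1)))) * (Real.sqrt ((L : ℝ) ^ d))⁻¹ := by
  haveI := lev_neZero L k
  have hδS : 0 ≤ (1 + c) ^ ((d + 1) * L) - 1 := by have := one_le_pow₀ (M₀ := ℝ) (a := 1 + c) (by linarith) (n := (d + 1) * L); linarith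
  rw [QlinStep_eq, QlinStep_eq, add_sub_add_comm]
  have h1 : ‖QmainStep L M W' k - QmainStep L M W k‖ ≤ Fintype.card o * ((1 + c) ^ ((d + 1) * L) - 1) * (Real.sqrt ((L : ℝ) ^ d))⁻¹ :=
    opNorm_Qstep_sub_Qstep_le (lev L k) L M hδS fun x r μ s => norm_Smain_sub_Smain_le (lev L k) L M hc hWn hWW x r μ s
  have h2 : ‖QremStep L M W' C' k - QremStep L M W C k‖
      ≤ Fintype.card o * (2 * d * ((2 * d + 2) * (L : ℝ) ^ d * (δG + γ * (δR + 2 * ((1 + c) ^ ((d + 1) * L) - 1))))) * (Real.sqrt ((L : ℝ) ^ d))⁻¹ :=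
    opNorm_Qrem_sub_le (lev L k) L M hγ hc hWn hW'n hWW hG₁ hG₂ hG₃ hRc hRc' hδG hδR hGG₁ hGG₂ hGG₃ hRR
  refine (norm_add_le _ _).trans ((add_le_add h1 h2).trans (le_of_eq ?_))
  rw [cR]; ring

/-- **THE DIFFERENCE OF TWO COMPOSED FULL AVERAGINGS, PRODUCT FORM**: with per-step letters `ε′_i` (size of the primed steps), `Δ_i` (size of the step differences), and `F` a bound on
`‖√(n_i^d)·Q^{full}(W,C)_i‖`, `‖√(n_k^d)·(Q^{full}(W′,C′)_k − Q^{full}(W,C)_k)‖ ≤ F·(Σ_{i<k} Δ_i)·Π_{i<k}(1 + ε′_i)`. [folklore] -/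
theorem opNorm_sqrtVol_smul_QfullLev_sub_le {W W' : (i : ℕ) → Fin d → (idx L M i → Matrix o o ℂ)} {C C' : RemCoeff d L M o} {F : ℝ} {ε Δ : ℕ → ℝ}
    (hF : 0 ≤ F) (hε : ∀ i, 0 ≤ ε i) (hΔ : ∀ i, 0 ≤ Δ i)
    (hfull : ∀ i, ‖sqrtVol d L i • QfullLev L M W C i‖ ≤ F)
    (hstep' : ∀ i, ‖QlinStep L M W' C' i‖ ≤ (1 + ε i) * (Real.sqrt ((L : ℝ) ^ d))⁻¹)
    (hdiff : ∀ i, ‖QlinStep L M W' C' i - QlinStep L M W C i‖ ≤ Δ i * (Real.sqrt ((L : ℝ) ^ d))⁻¹) (k : ℕ) :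
    ‖sqrtVol d L k • (QfullLev L M W' C' k - QfullLev L M W C k)‖ ≤ F * (∑ i ∈ range k, Δ i) * ∏ i ∈ range k, (1 + ε i) := by
  have hsL : (0 : ℝ) < Real.sqrt ((L : ℝ) ^ d) := Real.sqrt_pos.mpr (pow_pos (by exact_mod_cast Nat.pos_of_ne_zero (NeZero.ne L)) d)
  have hnsL : ‖((Real.sqrt ((L : ℝ) ^ d) : ℝ) : ℂ)‖ = Real.sqrt ((L : ℝ) ^ d) := by rw [Complex.norm_real, Real.norm_of_nonneg hsL.le]
  induction k with
  | zero => simp [QfullLev, QcovLevT, TBal_zero]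
  | succ k ih =>
    set e := ‖sqrtVol d L k • (QfullLev L M W' C' k - QfullLev L M W C k)‖ with he
    have he0 : 0 ≤ e := norm_nonneg _
    have hP1 : 1 ≤ ∏ i ∈ range k, (1 + ε i) := by
      calc (1 : ℝ) = ∏ _i ∈ range k, (1 : ℝ) := Finset.prod_const_one.symm
        _ ≤ ∏ i ∈ range k, (1 + ε i) := Finset.prod_le_prod (fun _ _ => zero_le_one) fun i _ => le_add_of_nonneg_right (hε i)
    have hS0 : 0 ≤ ∑ i ∈ range k, Δ i := Finset.sum_nonneg fun i _ => hΔ i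
    have hstep : ‖sqrtVol d L (k + 1) • (QfullLev L M W' C' (k + 1) - QfullLev L M W C (k + 1))‖ ≤ e * (1 + ε k) + F * Δ k := by
      rw [sqrtVol_smul_QfullLev_sub_succ, norm_smul, hnsL]
      have h1 : ‖(sqrtVol d L k • (QfullLev L M W' C' k - QfullLev L M W C k)) * QlinStep L M W' C' k‖ ≤ e * ((1 + ε k) * (Real.sqrt ((L : ℝ) ^ d))⁻¹) :=
        (Matrix.l2_opNorm_mul _ _).trans (mul_le_mul_of_nonneg_left (hstep' k) he0)
      have h2 : ‖(sqrtVol d L k • QfullLev L M W C k) * (QlinStep L M W' C' k - QlinStep L M W C k)‖ ≤ F * (Δ k * (Real.sqrt ((L : ℝ) ^ d))⁻¹) :=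
        (Matrix.l2_opNorm_mul _ _).trans (mul_le_mul (hfull k) (hdiff k) (norm_nonneg _) hF)
      calc Real.sqrt ((L : ℝ) ^ d) * ‖(sqrtVol d L k • (QfullLev L M W' C' k - QfullLev L M W C k)) * QlinStep L M W' C' k
              + (sqrtVol d L k • QfullLev L M W C k) * (QlinStep L M W' C' k - QlinStep L M W C k)‖
          ≤ Real.sqrt ((L : ℝ) ^ d) * (e * ((1 + ε k) * (Real.sqrt ((L : ℝ) ^ d))⁻¹) + F * (Δ k * (Real.sqrt ((L : ℝ) ^ d))⁻¹)) :=
            mul_le_mul_of_nonneg_left ((norm_add_le _ _).trans (add_le_add h1 h2)) hsL.le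
        _ = e * (1 + ε k) + F * Δ k := by field_simp
    refine hstep.trans ?_
    rw [Finset.sum_range_succ, Finset.prod_range_succ]
    have ih' : e ≤ F * (∑ i ∈ range k, Δ i) * ∏ i ∈ range k, (1 + ε i) := ih
    have a1 : e * (1 + ε k) ≤ F * (∑ i ∈ range k, Δ i) * (∏ i ∈ range k, (1 + ε i)) * (1 + ε k) := mul_le_mul_of_nonneg_right ih' (by linarith [hε k])
    have a2 : F * Δ k ≤ F * Δ k * ((∏ i ∈ range k, (1 + ε i)) * (1 + ε k)) :=
      le_mul_of_one_le_right (mul_nonneg hF (hΔ k)) (one_le_mul_of_one_le_of_one_le hP1 (by linarith [hε k]))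
    refine (add_le_add a1 a2).trans (le_of_eq ?_)
    ring

/-- **THE COMPOSED REMAINDER AS A FUNCTION OF ITS DATA**: `‖E″(W′,C′)_k − E″(W,C)_k‖ ≤ ‖√(n_k^d)(Q^{full′}_k − Q^{full}_k)‖ + card o·θ_k`, `θ_k` = the entrywise bound on
`T_Bal(W′)_k − T_Bal(W)_k` (gen 4's `consBal` by `CovariantTableBalabanTwoLevel.norm_prefix_sub_prefix_le`). [folklore] -/
theorem opNorm_Erem_sub_Erem_le {W W' : (i : ℕ) → Fin d → (idx L M i → Matrix o o ℂ)} {C C' : RemCoeff d L M o} {θ : ℝ} (hθ : 0 ≤ θ) (k : ℕ)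
    (hT : ∀ y j μ (t : Fin (lev L k)), ‖TBal L M W' k y j μ t - TBal L M W k y j μ t‖ ≤ θ) :
    ‖Erem L M W' C' k - Erem L M W C k‖ ≤ ‖sqrtVol d L k • (QfullLev L M W' C' k - QfullLev L M W C k)‖ + Fintype.card o * θ := by
  have e : Erem L M W' C' k - Erem L M W C k
      = sqrtVol d L k • (QfullLev L M W' C' k - QfullLev L M W C k) - (EcovT L M (fun k => TBal L M W' k) k - EcovT L M (fun k => TBal L M W k) k) := by
    rw [Erem, Erem, smul_sub]; abel
  rw [e]
  exact (norm_sub_le _ _).trans (add_le_add le_rfl (opNorm_EcovT_sub_EcovT_le L M (T := fun k => TBal L M W k) (T' := fun k => TBal L M W' k) hθ k hT))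

end Tower

end Summit.QuantumFields.BalabanUV.T4Continuum.NE2.ComposedRemainderLipschitz

end
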